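import Summits.AtomisticToContinuum.Crystallization.Theses.ReggeStarCoercivity
import Summits.AtomisticToContinuum.Crystallization.Theorems.ChargedEnergyGap.Negative.BlocksBound
import Literature.Geometry.DiscreteGeometry.KissingPatterns

/-!
# Line `relative-reference-torus` for the crux `ReggeStarCoercivity.PeriodicStarCoercivity`
(item stmt-AtomisticToContinuum-13602; crux-plan round 1, planner
`planner-cruxplan-stmt-AtomisticToContinuum-13602-relative-reference-t-0`, 2026-08-16)

Crux (route file l.366, fixed): `∃ g > 0, ∀ P : PeriodicConfiguration 3, ePer + g·#def(P)/#motif(P) ≤ e(P)`,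
`ePer = ⨅_Q e(Q)` (Lennard-Jones, Blanc–Lewin units), a motif point being *defective* unless its recentred
`6/5`-shell, rescaled by some `a ∈ [9/10, 11/10]`, is `1/20`-`ShellCloseTo` the fcc or the hcp kissing pattern.

## The line (idea card `relative-reference-torus`, ideator 1; triage r1-1/2/3: pass, merge ≈ same-word)

Never evaluate `ePer`.  Every charge is booked against a PERIODIC REFERENCE `Q` manufactured from `P`
itself (`e(Q) ≥ ePer` is then free: `ciInf_le` + the landed 0714 theorem
`ChargedEnergyGapNegative.bddBelow_energyPerParticle_lennardJones`), and the reference is an EQUILIBRIUM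
among periodic configurations (relaxed Barlow stacking of `P`'s own Hägg word, cell metric free), so on the
torus `ℝ³/G` the first variation of `e` in the direction `P − Q` vanishes identically — no boundary, no
`N^{2/3}` — and the comparison `e(P) − e(Q)` starts at second order (phonon/cell coercivity).  Sites are sorted
by a TUBE of radius `ηT = 1/10` around the two Barlow patterns (the crux's tolerance `1/20` is its inner half):

* FREE            — `1/20`-close (uncharged by the crux);
* NEAR-DEFECTIVE  — inside the tube but not `1/20`-close: charged by the relative reference at rate `c₁`
                    (second variation ≥ generalized phonon gap × `(a/20)²`; EOS/rigidity inequality for the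
                    scale-defective part of the tube);
* WILD            — outside the tube (wrong coordination, 5-fold/icosahedral shells, > 10 % distortion): the
                    near engine REFUNDS `C₁` per wild site (collar + interface flux, first-order coupling of junk
                    to the matrix), and a far certificate charges wild sites SOME `c₂, c₃ > 0` — it only has to
                    certify that wild zones carry positive EXCESS, at percent accuracy, never that the excess
                    beats the refund: the composition is the convex combination
                    `g = c₁ · c_f / (c_f + C₁)`, `c_f = min c₂ c₃`.

## Registered stubs (the only `sorry`s of the file) and the composition

* `stub_nearTubeCoercivity` : `NearTubeCoercivity` — ∃ c₁ > 0, C₁ ≥ 0, ∀ P ∃ Q, e Q + c₁·defectFrac P − C₁·wildFrac P ≤ e P.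
* `stub_sparseWildExcess`  : `SparseWildExcess`  — ∃ c₂ > 0, ∀ P, wildFrac P ≤ 1/2 → ∃ Q, e Q + c₂·wildFrac P ≤ e P.
* `stub_denseWildGap`      : `DenseWildGap`      — ∃ c₃ > 0, ∀ P, 1/2 ≤ wildFrac P → ∃ Q, e Q + c₃ ≤ e P.
* `PeriodicStarCoercivity_of : Registered.stub_nearTubeCoercivity → Registered.stub_sparseWildExcess →
   Registered.stub_denseWildGap → ReggeStarCoercivity.PeriodicStarCoercivity` — PROVED (no sorry): `ciInf_le` on
   each reference, case split `wildFrac ≤ 1/2 ∨ 1/2 ≤ wildFrac` for the far rate `c_f = min c₂ c₃`, then the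
   convex combination above; `crux_iff` identifies the named vocabulary with the route decl
   (`unfold; simp only [mul_div_assoc]`).
* LOSSLESS: `stubs_of_crux : PeriodicStarCoercivity → NearTubeCoercivity ∧ SparseWildExcess ∧ DenseWildGap`
  (PROVED; `exists_lt_of_ciInf_lt`, `wildFrac ≤ defectFrac` by `EtaMatched.mono`), hence
  `crux_iff_stubs : PeriodicStarCoercivity ↔ (S₁ ∧ S₂ ∧ S₃)` — no stub can be false unless the crux is, and none
  restates it: S₁ leaves near-defective sites of wild-rich configurations uncharged (refund), S₂/S₃ never
  charge a near-defective site.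

The named statements use `Registered.stub_*` aliases as the hypotheses of the composition (the native skeleton
audit admits a `Prop` hypothesis by the last name component of its head; same device as
`Cruxes/SomeWindowSaving/Lines/inert-box-collapse.lean` on the ABC summit).

## Disproof used (`Cruxes/PeriodicStarCoercivity/Disproof.lean`, cdisprove gen-2 v4, verdict RESISTS)

No `_false_without_<H>` theorem exists for this crux, so no hypothesis is mandated.  Honoured / checked:
`psc_iff`/`pscAt_iff` (our `crux_iff` is the same re-association); `not_pscWith_zero` (gen-1, η = 0 false by
shear) — every charge here is quadratic in the POSITIVE tolerance (`(a/20)²`), vanishing as η → 0;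
`not_periodicStarCoercivityForallG` / `g_le_of_allDefective` / `not_pscAt_six_fifths` / `not_pscAt_three_fifths`
(ceilings g ≤ 0.56 certified, ≈ 4.3e-3 numerically) — consistent: the composed `g = c₁c_f/(c_f + C₁)` is tiny,
and S₃ tested on the file's own witnesses (dilute `2ℤ³`: e ≤ 0; bcc: e ≤ −0.633, all sites wild) needs only
`c₃ ≤ e(bcc) − e(hcp) ≈ 0.03`; `not_pscCount` — fractions throughout; `siteCoercivity_imp_psc` + §5.1 (per-site
strengthening is a dead end) — every stub is a GLOBAL comparison `e(Q) + charge ≤ e(P)` summed over the motif,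
never a per-site bound (an over-coordinated wild site has LOWER site energy; its cost sits at the neighbours and
is certified on stars, S₂/S₃); §5.3 threshold crossings — the binding competitor (hcp optical shuffle pinned at
u ↓ 1/20, excess 4.3–5.0e-3) is a near-defective configuration with `wildFrac = 0`, i.e. the pure content of S₁.
No landed `Theorems/PeriodicStarCoercivity/Negative/*` module exists yet (nothing to import); the item-evidence
refutations live in the Disproof work file and none of S₁–S₃ instantiates them (each Sᵢ is implied by the crux).
0714 is taken from the tree (`bddBelow_energyPerParticle_lennardJones`), not assumed.
-/

noncomputable section

open scoped BigOperators Classical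
open Literature.MathematicalPhysics.StatisticalMechanics Literature.Geometry.DiscreteGeometry

namespace Summit.AtomisticToContinuum.Crystallization.Cruxes.PeriodicStarCoercivity.RelativeReferenceTorus

/-! ## Vocabulary — verbatim sub-terms of the crux, named -/

/-- The recentred first shell of `s` in `P` (other points of `P.points` within ABSOLUTE radius `6/5`),
rescaled by `a⁻¹` — verbatim the sub-term of the route decl. -/
def shell (P : PeriodicConfiguration 3) (s : EuclideanSpace ℝ (Fin 3)) (a : ℝ) :
    Finset (EuclideanSpace ℝ (Fin 3)) :=
  (P.finite_inter_points (K := Metric.closedBall s (6 / 5) \ {s})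
      (Metric.isBounded_closedBall.subset Set.sdiff_subset)).toFinset.image fun y => a⁻¹ • (y - s)

/-- `s` is `η`-FREE in `P`: at some admissible scale `a ∈ [9/10, 11/10]` its rescaled shell is `η`-close
(linear isometry + bijection, `ℓ∞`) to the fcc or the hcp kissing pattern.  The crux's "non-defective" is
`IsFreeAt (1/20)`; "inside the tube" is `IsFreeAt ηT`. -/
def IsFreeAt (η : ℝ) (P : PeriodicConfiguration 3) (s : EuclideanSpace ℝ (Fin 3)) : Prop :=
  ∃ a : ℝ, 9 / 10 ≤ a ∧ a ≤ 11 / 10 ∧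
    (ShellCloseTo η (shell P s a) fccKissingPattern ∨ ShellCloseTo η (shell P s a) hcpKissingPattern)

/-- The TUBE RADIUS of the line: shells within `ℓ∞`-distortion `1/10` of a Barlow pattern are handled by the
relative reference (near engine); the crux's tolerance `1/20` is the inner half of the tube. -/
def ηT : ℝ := 1 / 10

/-- Fraction of motif points that are not `η`-free. -/
def badFrac (η : ℝ) (P : PeriodicConfiguration 3) : ℝ :=
  ((P.motif.filter fun s => ¬ IsFreeAt η P s).card : ℝ) / (P.motif.card : ℝ)

/-- The crux's charge: fraction of `1/20`-defective motif points. -/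
def defectFrac (P : PeriodicConfiguration 3) : ℝ := badFrac (1 / 20) P

/-- The WILD fraction: motif points whose shell is outside the tube (not `1/10`-close to any Barlow pattern
at any admissible scale: wrong coordination, 5-fold/icosahedral shells, distortion `> 10 %`). -/
def wildFrac (P : PeriodicConfiguration 3) : ℝ := badFrac ηT P

/-- Lennard-Jones energy per particle. -/
def e (P : PeriodicConfiguration 3) : ℝ := P.energyPerParticle lennardJones

/-- `ePer = ⨅_Q e(Q)`, the periodic infimum — never evaluated on this line. -/
def ePer : ℝ := ⨅ Q : PeriodicConfiguration 3, e Q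

/-- The named vocabulary IS the route decl (re-association `g * #def / #motif = g * defectFrac`). -/
theorem crux_iff :
    Summit.AtomisticToContinuum.Crystallization.Theses.ReggeStarCoercivity.PeriodicStarCoercivity ↔
      ∃ g : ℝ, 0 < g ∧ ∀ P : PeriodicConfiguration 3, ePer + g * defectFrac P ≤ e P := by
  unfold Summit.AtomisticToContinuum.Crystallization.Theses.ReggeStarCoercivity.PeriodicStarCoercivity
    ePer e defectFrac badFrac IsFreeAt shell
  simp only [mul_div_assoc]

/-! ## Elementary facts about the fractions -/

theorem motif_card_pos (P : PeriodicConfiguration 3) : 0 < (P.motif.card : ℝ) :=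
  Nat.cast_pos.2 (Finset.card_pos.2 P.motif_nonempty)

theorem badFrac_nonneg (η : ℝ) (P : PeriodicConfiguration 3) : 0 ≤ badFrac η P :=
  div_nonneg (Nat.cast_nonneg _) (Nat.cast_nonneg _)

theorem badFrac_le_one (η : ℝ) (P : PeriodicConfiguration 3) : badFrac η P ≤ 1 := by
  unfold badFrac
  rw [div_le_one (motif_card_pos P)]
  exact_mod_cast Finset.card_filter_le _ _

/-- Freeness is monotone in the tolerance (`EtaMatched.mono` under the isometry). -/
theorem IsFreeAt.mono {η η' : ℝ} (hη : η ≤ η') {P : PeriodicConfiguration 3}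
    {s : EuclideanSpace ℝ (Fin 3)} (h : IsFreeAt η P s) : IsFreeAt η' P s := by
  obtain ⟨a, ha, ha', hclose⟩ := h
  refine ⟨a, ha, ha', ?_⟩
  rcases hclose with ⟨A, hA⟩ | ⟨A, hA⟩
  · exact Or.inl ⟨A, hA.mono hη⟩
  · exact Or.inr ⟨A, hA.mono hη⟩

/-- A larger tolerance charges fewer sites. -/
theorem badFrac_anti {η η' : ℝ} (hη : η ≤ η') (P : PeriodicConfiguration 3) :
    badFrac η' P ≤ badFrac η P := by
  unfold badFrac
  refine div_le_div_of_nonneg_right ?_ (motif_card_pos P).le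
  refine Nat.cast_le.2 (Finset.card_le_card fun s hs => ?_)
  simp only [Finset.mem_filter] at hs ⊢
  exact ⟨hs.1, fun hf => hs.2 (hf.mono hη)⟩

theorem defectFrac_nonneg (P : PeriodicConfiguration 3) : 0 ≤ defectFrac P := badFrac_nonneg _ P
theorem wildFrac_nonneg (P : PeriodicConfiguration 3) : 0 ≤ wildFrac P := badFrac_nonneg _ P
theorem wildFrac_le_one (P : PeriodicConfiguration 3) : wildFrac P ≤ 1 := badFrac_le_one _ P

/-- Wild sites are defective: `wildFrac ≤ defectFrac` (`1/20 ≤ 1/10`). -/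
theorem wildFrac_le_defectFrac (P : PeriodicConfiguration 3) : wildFrac P ≤ defectFrac P :=
  badFrac_anti (by norm_num [ηT]) P

/-- `ePer ≤ e(Q)` for every periodic `Q` — the only place `ePer` is ever touched (item 0714, landed as
`ChargedEnergyGapNegative.bddBelow_energyPerParticle_lennardJones`). -/
theorem ePer_le (Q : PeriodicConfiguration 3) : ePer ≤ e Q :=
  ciInf_le (f := fun Q : PeriodicConfiguration 3 => e Q)
    Summit.AtomisticToContinuum.Crystallization.Theorems.ChargedEnergyGapNegative.bddBelow_energyPerParticle_lennardJones
    Q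

/-! ## The three stub STATEMENTS (named `Prop`s) -/

/-- **S₁ · NEAR-TUBE COERCIVITY WITH WILD REFUND** (the line's own engine).  There are `c₁ > 0`, `C₁ ≥ 0`
such that every periodic `P` is beaten by SOME periodic reference `Q` by `c₁` per `1/20`-defective site, up to
a refund of `C₁` per wild site: `e(Q) + c₁·defectFrac P − C₁·wildFrac P ≤ e(P)`.  Intended `Q`: the relaxed
Barlow stacking of `P`'s own word (cell metric, layer spacings and in-plane constant free; an equilibrium, so
the first variation vanishes on the torus), or an interpolation vertex among the finitely many words of `P`'s
columns when partial dislocations (wild) make the word in-plane inconsistent; `Q := P` when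
`C₁·wildFrac ≥ c₁·defectFrac`.  Content: generalized phonon gap of every Barlow polytype against the linearised
defect test (`excess ≥ c_w (a/20)²` per residual-defective site; numerically `c_w ≈ 0.26–0.52` over
{fcc, hcp, dhcp, 6H, 9R} incl. the affine `k → 0` limits, kit j005679 + TRIAGE-r1-3 N2; binding competitor the
hcp optical shuffle pinned at `u ↓ 1/20`, `g* ≈ 4.3e-3`), an EOS/rigidity inequality for the scale-defective
part of the tube (excess ≥ 0.30 per site there), anharmonic control up to 10 % distortion, the `1/10`-robust
layer/chart lemma, and the collar/interface refund.  Implied by the crux (`c₁ := g/2`, `C₁ := 0`). -/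
def NearTubeCoercivity : Prop :=
  ∃ c₁ : ℝ, 0 < c₁ ∧ ∃ C₁ : ℝ, 0 ≤ C₁ ∧ ∀ P : PeriodicConfiguration 3, ∃ Q : PeriodicConfiguration 3,
    e Q + c₁ * defectFrac P - C₁ * wildFrac P ≤ e P

/-- **S₂ · SPARSE-WILD EXCESS** (far certificate, relative form).  There is `c₂ > 0` such that every periodic
`P` with at most half of its motif wild is beaten by some periodic reference `Q` by `c₂` per wild site.
Intended `Q`: the relaxed Barlow stacking of the word of `P`'s near matrix (the lowest among the finitely many
grain/column words); content: a LOCAL certificate on wild zones ∪ collars (Delaunay edge-star and vertex-star LP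
duals of the route, or cluster comparison) showing positive formation excess per wild site relative to continuing
the matrix — precision ~1e-2 (vacancy neighbourhoods 0.06/wild site, threshold-`1/10` shuffles 0.02, displaced
atoms 0.015), never sharpness at `ePer`.  Implied by the crux (`c₂ := g/2`). -/
def SparseWildExcess : Prop :=
  ∃ c₂ : ℝ, 0 < c₂ ∧ ∀ P : PeriodicConfiguration 3, wildFrac P ≤ 1 / 2 →
    ∃ Q : PeriodicConfiguration 3, e Q + c₂ * wildFrac P ≤ e P

/-- **S₃ · DENSE-WILD GAP** (far certificate, absolute form).  There is `c₃ > 0` such that every periodic `P`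
with at least half of its motif wild lies `c₃` above some periodic configuration (intended `Q := hcp` at its
optimal scale, explicit in the tree as `hcpPeriodicConfiguration`): an ABSOLUTE lower bound
`e(P) ≥ e(hcp) + c₃` on the wild-dominated class at percent accuracy (numerics, BL units, excess over
e(hcp) = −0.7176: bcc +0.031, sc +0.24, A15 +0.086, diamond +0.45, vacancy superlattice with 1/24 vacancies
≈ +0.03, hcp/bcc slabs ≈ +0.015 + interface; Frank–Kasper σ uncomputed, estimated ~1e-2 — the cheapest
falsifier) — the route's Delaunay-star LP with `1e-2` slack instead of exactness at `ePer`.  Implied by the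
crux (`c₃ := g/4`). -/
def DenseWildGap : Prop :=
  ∃ c₃ : ℝ, 0 < c₃ ∧ ∀ P : PeriodicConfiguration 3, 1 / 2 ≤ wildFrac P →
    ∃ Q : PeriodicConfiguration 3, e Q + c₃ ≤ e P

/-! ## The registered stubs (`sorry` lives only in these three theorems) -/

/-- **STUB 1 · `stub_nearTubeCoercivity`** (= `NearTubeCoercivity` verbatim; size XL; the load-bearing stub). -/
theorem stub_nearTubeCoercivity :
    ∃ c₁ : ℝ, 0 < c₁ ∧ ∃ C₁ : ℝ, 0 ≤ C₁ ∧ ∀ P : PeriodicConfiguration 3, ∃ Q : PeriodicConfiguration 3,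
      e Q + c₁ * defectFrac P - C₁ * wildFrac P ≤ e P := by
  sorry

/-- **STUB 2 · `stub_sparseWildExcess`** (= `SparseWildExcess` verbatim; size L–XL). -/
theorem stub_sparseWildExcess :
    ∃ c₂ : ℝ, 0 < c₂ ∧ ∀ P : PeriodicConfiguration 3, wildFrac P ≤ 1 / 2 →
      ∃ Q : PeriodicConfiguration 3, e Q + c₂ * wildFrac P ≤ e P := by
  sorry

/-- **STUB 3 · `stub_denseWildGap`** (= `DenseWildGap` verbatim; size XL; the hardest by sheer size). -/
theorem stub_denseWildGap :
    ∃ c₃ : ℝ, 0 < c₃ ∧ ∀ P : PeriodicConfiguration 3, 1 / 2 ≤ wildFrac P →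
      ∃ Q : PeriodicConfiguration 3, e Q + c₃ ≤ e P := by
  sorry

/-! ### Consistency: each named statement IS its registered stub (definitionally) -/

theorem nearTubeCoercivity_holds : NearTubeCoercivity := stub_nearTubeCoercivity
theorem sparseWildExcess_holds : SparseWildExcess := stub_sparseWildExcess
theorem denseWildGap_holds : DenseWildGap := stub_denseWildGap

/-! ### Name-keyed aliases of the statements (the hypotheses of the composition) -/
namespace Registered

/-- Alias of `NearTubeCoercivity` keyed by the registered stub name. -/
abbrev stub_nearTubeCoercivity : Prop := NearTubeCoercivity
/-- Alias of `SparseWildExcess` keyed by the registered stub name. -/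
abbrev stub_sparseWildExcess : Prop := SparseWildExcess
/-- Alias of `DenseWildGap` keyed by the registered stub name. -/
abbrev stub_denseWildGap : Prop := DenseWildGap

end Registered

/-! ## Proved glue -/

/-- The far rate: from S₂ and S₃, every periodic `P` pays `min c₂ c₃` per wild site against `ePer`. -/
theorem far_charge (h₂ : SparseWildExcess) (h₃ : DenseWildGap) :
    ∃ cf : ℝ, 0 < cf ∧ ∀ P : PeriodicConfiguration 3, ePer + cf * wildFrac P ≤ e P := by
  obtain ⟨c₂, hc₂, hS⟩ := h₂
  obtain ⟨c₃, hc₃, hD⟩ := h₃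
  refine ⟨min c₂ c₃, lt_min hc₂ hc₃, fun P => ?_⟩
  have hw0 := wildFrac_nonneg P
  have hw1 := wildFrac_le_one P
  rcases le_total (wildFrac P) (1 / 2) with hle | hge
  · obtain ⟨Q, hQ⟩ := hS P hle
    have hPer := ePer_le Q
    have hmin : min c₂ c₃ * wildFrac P ≤ c₂ * wildFrac P :=
      mul_le_mul_of_nonneg_right (min_le_left _ _) hw0
    linarith
  · obtain ⟨Q, hQ⟩ := hD P hge
    have hPer := ePer_le Q
    have hmin : min c₂ c₃ * wildFrac P ≤ c₃ := by
      calc min c₂ c₃ * wildFrac P ≤ min c₂ c₃ * 1 :=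
            mul_le_mul_of_nonneg_left hw1 (lt_min hc₂ hc₃).le
        _ ≤ c₃ := by rw [mul_one]; exact min_le_right _ _
    linarith

/-- The near charge against `ePer`: from S₁, `ePer + c₁·defectFrac − C₁·wildFrac ≤ e`. -/
theorem near_charge (h₁ : NearTubeCoercivity) :
    ∃ c₁ : ℝ, 0 < c₁ ∧ ∃ C₁ : ℝ, 0 ≤ C₁ ∧ ∀ P : PeriodicConfiguration 3,
      ePer + c₁ * defectFrac P - C₁ * wildFrac P ≤ e P := by
  obtain ⟨c₁, hc₁, C₁, hC₁, hN⟩ := h₁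
  refine ⟨c₁, hc₁, C₁, hC₁, fun P => ?_⟩
  obtain ⟨Q, hQ⟩ := hN P
  have hPer := ePer_le Q
  linarith

/-- **The convex combination.**  A near charge with refund (`c₁`, `C₁`) and a far charge `cf` give the crux's
charge `g = c₁·cf/(cf + C₁)` on ALL defective sites: `cf·(near) + C₁·(far)` cancels the refund. -/
theorem coercivity_of_charges {c₁ C₁ cf : ℝ} (hc₁ : 0 < c₁) (hC₁ : 0 ≤ C₁) (hcf : 0 < cf)
    (near : ∀ P : PeriodicConfiguration 3, ePer + c₁ * defectFrac P - C₁ * wildFrac P ≤ e P)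
    (far : ∀ P : PeriodicConfiguration 3, ePer + cf * wildFrac P ≤ e P) :
    ∃ g : ℝ, 0 < g ∧ ∀ P : PeriodicConfiguration 3, ePer + g * defectFrac P ≤ e P := by
  have hden : 0 < cf + C₁ := by linarith
  refine ⟨c₁ * cf / (cf + C₁), by positivity, fun P => ?_⟩
  have h1 := near P
  have h2 := far P
  have key : c₁ * cf * defectFrac P ≤ (e P - ePer) * (cf + C₁) := by
    have h1' := mul_le_mul_of_nonneg_left h1 hcf.le
    have h2' := mul_le_mul_of_nonneg_left h2 hC₁
    nlinarith [h1', h2']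
  have key' : c₁ * cf / (cf + C₁) * defectFrac P ≤ e P - ePer := by
    rw [div_mul_eq_mul_div, div_le_iff₀ hden]
    exact key
  linarith

/-! ## The composition: the three stubs imply the crux, BY NAME (kernel-checked; no `sorry` below) -/

/-- **`PeriodicStarCoercivity_of`** — the glue of the line: references are free against `ePer`
(`ePer_le`, item 0714 from the tree), the two far stubs give a far rate `min c₂ c₃` (`far_charge`), the near
stub gives the near rate with refund (`near_charge`), and the convex combination `coercivity_of_charges`
yields `g = c₁·min c₂ c₃ / (min c₂ c₃ + C₁) > 0`; `crux_iff` lands in the route decl by name. -/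
theorem PeriodicStarCoercivity_of (h₁ : Registered.stub_nearTubeCoercivity)
    (h₂ : Registered.stub_sparseWildExcess) (h₃ : Registered.stub_denseWildGap) :
    Summit.AtomisticToContinuum.Crystallization.Theses.ReggeStarCoercivity.PeriodicStarCoercivity := by
  obtain ⟨c₁, hc₁, C₁, hC₁, near⟩ := near_charge h₁
  obtain ⟨cf, hcf, far⟩ := far_charge h₂ h₃
  exact crux_iff.2 (coercivity_of_charges hc₁ hC₁ hcf near far)

/-! ## The split is lossless: the crux implies each stub (sorry-free) -/

/-- If `ePer < b` there is a periodic `Q` with `e(Q) < b` (`ePer` is a genuine infimum over a nonempty type). -/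
theorem exists_e_lt {b : ℝ} (h : ePer < b) : ∃ Q : PeriodicConfiguration 3, e Q < b :=
  exists_lt_of_ciInf_lt (f := fun Q : PeriodicConfiguration 3 => e Q) h

/-- Crux ⟹ S₁ (take `c₁ := g/2`, `C₁ := 0`; `Q := P` when nothing is defective, else a near-minimiser). -/
theorem nearTubeCoercivity_of_crux
    (h : Summit.AtomisticToContinuum.Crystallization.Theses.ReggeStarCoercivity.PeriodicStarCoercivity) :
    NearTubeCoercivity := by
  obtain ⟨g, hg, hP⟩ := crux_iff.1 h
  refine ⟨g / 2, by positivity, 0, le_rfl, fun P => ?_⟩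
  have hd := defectFrac_nonneg P
  rcases hd.eq_or_lt with h0 | hpos
  · exact ⟨P, by rw [← h0]; simp⟩
  · have hlt : ePer < e P - g / 2 * defectFrac P := by
      have := hP P
      nlinarith
    obtain ⟨Q, hQ⟩ := exists_e_lt hlt
    exact ⟨Q, by rw [zero_mul, sub_zero]; linarith⟩

/-- Crux ⟹ S₂ (take `c₂ := g/2`; wild sites are defective). -/
theorem sparseWildExcess_of_crux
    (h : Summit.AtomisticToContinuum.Crystallization.Theses.ReggeStarCoercivity.PeriodicStarCoercivity) :
    SparseWildExcess := by
  obtain ⟨g, hg, hP⟩ := crux_iff.1 h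
  refine ⟨g / 2, by positivity, fun P _ => ?_⟩
  have hw := wildFrac_nonneg P
  have hwd := wildFrac_le_defectFrac P
  rcases hw.eq_or_lt with h0 | hpos
  · exact ⟨P, by rw [← h0]; simp⟩
  · have hlt : ePer < e P - g / 2 * wildFrac P := by
      have := hP P
      nlinarith
    obtain ⟨Q, hQ⟩ := exists_e_lt hlt
    exact ⟨Q, by linarith⟩

/-- Crux ⟹ S₃ (take `c₃ := g/4`). -/
theorem denseWildGap_of_crux
    (h : Summit.AtomisticToContinuum.Crystallization.Theses.ReggeStarCoercivity.PeriodicStarCoercivity) :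
    DenseWildGap := by
  obtain ⟨g, hg, hP⟩ := crux_iff.1 h
  refine ⟨g / 4, by positivity, fun P hhalf => ?_⟩
  have hwd := wildFrac_le_defectFrac P
  have hlt : ePer < e P - g / 4 := by
    have := hP P
    nlinarith
  obtain ⟨Q, hQ⟩ := exists_e_lt hlt
  exact ⟨Q, by linarith⟩

theorem stubs_of_crux
    (h : Summit.AtomisticToContinuum.Crystallization.Theses.ReggeStarCoercivity.PeriodicStarCoercivity) :
    NearTubeCoercivity ∧ SparseWildExcess ∧ DenseWildGap :=
  ⟨nearTubeCoercivity_of_crux h, sparseWildExcess_of_crux h, denseWildGap_of_crux h⟩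

/-- The line's split is an EQUIVALENCE: `PeriodicStarCoercivity ⟺ S₁ ∧ S₂ ∧ S₃` (one direction through the
registered stubs' statements, the other sorry-free). -/
theorem crux_iff_stubs :
    Summit.AtomisticToContinuum.Crystallization.Theses.ReggeStarCoercivity.PeriodicStarCoercivity ↔
      (NearTubeCoercivity ∧ SparseWildExcess ∧ DenseWildGap) :=
  ⟨stubs_of_crux, fun h => PeriodicStarCoercivity_of h.1 h.2.1 h.2.2⟩

end Summit.AtomisticToContinuum.Crystallization.Cruxes.PeriodicStarCoercivity.RelativeReferenceTorus

end
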